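import Mathlib
import HarnessLib
import HarnessLib.Audit
import Summits.QuantumFields.Statement
import HarnessLib.Audit.Status.Attr

/-!
Route: WilsonQuarkChessboard

DORMANT since 2026-08-26T05:43:59Z (reconciler: no traction for 8.4 d (last activity statement-closed at 2026-08-17T19:58:36Z); parked, not closed — `ledger route dormant route-QuantumFields-WilsonQuarkChessboard --off` to reactivate) — unstaffed, not closed; items shared with open routes are served there. `ledger route dormant <id> --off` reactivates.

# Route WilsonQuarkChessboard — chessboard domination of the Wilson quark determinant — RP Schwarz
at an asymmetric background plus a flat-cell optimum as the large-field fermion input of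
constructive QCD

It suffices to show X = C ∧ K ∧ M ∧ D (card QuantumFields/QCD/wilson-determinant-chessboard; since
the statement re-type p117723 of 2026-08-16 — `def QCDOf` gained the conjunct `reg.IsChiralAtZero` —
the one-shot bridge B = DominationBridge := C → K → `QCD`, which absorbs the new conjunct by name,
is the composite of M and D and is kept as a support decl). C (QUARK CHESSBOARD, decl
QuarkChessboard — PROVED @ b37869be232f): on every even four-torus of side L ≥ 4, for every U(N)
link field U and every Wilson bare mass m > −1 (r = 1, i.e. hopping parameter κ = 1/(2m+8) < 1/6),
the Wilson–Dirac determinant with antiperiodic b.c. in all four directions is dominated cell by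
cell, |det_AP D_W[U]|^(L⁴) ≤ Π_c det_AP D_W[R_c U], where R_c U is the period-2 field generated by
reflecting the 32 links of the closed unit hypercube c in the lattice hyperplanes through sites, and
every factor is real ≥ 0. K (FLAT CELL OPTIMAL, decl FlatCellOptimal): in a bare-mass window around
m = 0 (κ = 1/8, where the scaling sequence lives) every such reflection tiling has det_AP at most
the free antiperiodic determinant det_AP D_W[𝟙]. M (MASSIVE BRIDGE, decl MassiveBridge): C and K — a
pathwise, LOCAL, sign-free upper bound e^(−N_f Σ_c φ_c(U)), φ_c ≥ φ_flat, on the N_f-flavour quark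
weight of every gauge field — are the large-field fermion input from which a Bałaban-type block
renormalisation group with dynamical Wilson quarks, plus the SU(3) + massive-quark infrared, yields
MASSIVE QCD for N_f = 2, 3: the pre-retype statement in its threshold form (every mass tuple above
an unpinned flavour-blind offset M₀ ≥ 0, one mass-independent regularisation with HasMassScaling, OS
data tied to lattice QCD, dynamical quarks, one gap Δ of the full Hamiltonian, continuum and
lattice). D (CHIRAL DESCENT, decl ChiralDescent): threshold-massive QCD → `QCD` — the offset can be
pinned at the chiral point, where the lattice gap closes in physical units as m → 0⁺
(`reg.IsChiralAtZero`; Goldstone / anomaly physics, foreign to the determinant-domination engine and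
shared in substance with the chiral routes AnomalyRigidity, ChiralSpinWaves, EulerDescent). C rests
on the background Schwarz inequality S (decl BackgroundSchwarz, PROVED @ 2722fd865c09) and the
Fröhlich–Lieb chessboard iteration; the sharp global corollary |det_AP D_W[U]| ≤ det_AP D_W[𝟙] (decl
QuarkDiamagnetism) is filed as support so that refuters can attack it directly.
Lean: `QuarkChessboard ∧ FlatCellOptimal ∧ MassiveBridge ∧ ChiralDescent`

## Assembly
Pure logic: `closes : QuarkChessboard → FlatCellOptimal → MassiveBridge → ChiralDescent → QCD := fun
hC hK hM hD => hD (hM hC hK)` (planner Sketch.lean `closes4`, rc 0, axioms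
propext/Classical.choice/Quot.sound; `QCD` is the sub-problem decl `QCDOf 2 ∧ QCDOf 3` by name),
re-elaborated against Statement 4221001d7a42. BackgroundSchwarz, QuarkDiamagnetism and the composite
DominationBridge (= MassiveBridge followed by ChiralDescent: `fun hM hD hC hK => hD (hM hC hK)`,
Sketch.lean `dominationBridge_of_split`) are deliberately not hypotheses: S is the proved child of
C, the diamagnetic inequality is a corollary, and B is the one-shot form; the item Assembly records
the sharp path S → K → B → QCD.

Rationale: WHY THIS LINE. Mechanism (Lieb1994 eq. (6); LiebLoss1993 §3; FrohlichIsraelLiebSimon1978 §2 and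
Fröhlich–Lieb 1978 Thm 2.2 as reprinted in book:liebnd-statistical-mechanics pp. 251–253;
transplanted to gauge theory with fermions only by Goller–Porta arXiv:2501.10065, ℤ₂ links, d = 2,
Hamiltonian): Osterwalder–Seiler/Lüscher site-reflection positivity of r = 1 Wilson fermions
(Luscher1977; OsterwalderSeilerAnnPhys1978; MontvayMunster1994 (4.100)–(4.111), valid for EVERY
background with 6κ < 1) is read not as positivity of a state but as a Cauchy–Schwarz inequality in
the BACKGROUND FIELD at a fixed, non-symmetric U(N) configuration: |det_AP[U]|² ≤ det_AP[U₊ ∪ U₀ ∪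
θU₊] · det_AP[θU₋ ∪ U₀ ∪ U₋] with both factors ≥ 0 (S); the tree already has the reflection
(`GaugeConfig.negReflect`) and the link classes (`WilsonSiteRP.sitePosEdges/sharedEdges`) from the
proved bosonic site-RP; since rev 2 the item BackgroundSchwarz INLINES both (propext-equal to the
rev-1 term), and the route file deliberately does NOT load the module
`ConstructiveQFTWave0SiteRPProofs`, whose module closure (via ConstructiveQFTWave0Proofs and
StrongCouplingActivities down to Sweep1) carries ten unproved strong-coupling / Ising facts this
line never uses — Theorems files for this route should likewise not load that module (re-prove the
two reflection identities locally, or use only its sorry-free lemmas if the gate's constants cone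
stays clean). Iterating S over all translates and all four axes by the Fröhlich–Lieb maximiser
argument (which uses only Schwarz + cyclicity, not multilinearity) gives C, i.e. −log|det_AP D_W[U]|
≥ Σ_c φ_c(U) with an explicit gauge-invariant one-cell functional — locality of the quark effective
ACTION without any hopping expansion, and for N_f = 3 without touching the sign of det (every
comparison determinant is B(F,F) ≥ 0). Imported from mathematical physics of itinerant electrons
(flux-phase problem, Kennedy–Lieb RP at asymmetric classical backgrounds) and from classical RP
lattice theory (chessboard estimates); what prior QCD lines lack and this supplies is a
configuration-wise handle on the determinant where fields are rough: Bałaban's large-field machinery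
(Balaban1989LargeFieldII) needs that the quark weight does not reward roughness, and the marginal-RP
chessboard of card quarks-as-stable-action only bounds probabilities of bad regions, not the weight
pathwise. No probabilistic reformulation or expansion is used; K is a finite-dimensional
certified-computation problem (128 real dimensions per SU(3) cell) with one-loop screening as its
perturbative shadow. The negatives index is empty for this summit; the only falsified neighbour
(card hidden-diagonal-rp-wilson-quarks: no RP across DIAGONAL mirrors) concerns a different
reflection and is not used.

RANKED CRUXES. #2 QuarkChessboard (crux) — (card item (C), with K3's bookkeeping inside) for all N,
all even L ≥ 4, every U : GaugeConfig 4 L U(N) and every m > −1: writing det_AP[V] := det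
wilsonDirac (unitary fundamental rep) (V with the links (x,i), x_i = L−1, multiplied by −1) m 1
(antiperiodic b.c. in all four directions) and R_c U for the period-2 reflection tiling of the torus
by the closed unit cell with lowest corner c (link (x,j) ↦ U(fold x, j) if x_j − c_j is even,
(U(fold(x+e_j), j))⁻¹ if odd, fold y = c + ((y − c) mod 2)), every det_AP[R_c U] is real and ≥ 0 and
‖det_AP[U]‖^(L⁴) ≤ Π_(c : Site 4 L) Re det_AP[R_c U]. [deps: BackgroundSchwarz] [difficulty: L] (why
it might fail: det is NONLINEAR in the cell data and cells share links (8 cells per link): the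
Fröhlich–Lieb maximiser iteration must stay inside genuine gauge fields and handle zero factors
(0/0) for L/2 not a power of 2; a hidden b.c.-sector mismatch between axes would break cyclicity.)
[FrohlichIsraelLiebSimon1978, LiebLoss1993, Lieb1994, book:liebnd-statistical-mechanics pp. 251–253
(Fröhlich–Lieb 1978 Thm 2.2 and the Lemma z = 1), arXiv:2501.10065, Biskup2009]
#3 FlatCellOptimal (crux) — (card K1, finite-volume form) there is δ > 0 such that for all N, all
even L ≥ 4, every U(N) field U, every cell c and every bare mass m ∈ (−δ, δ) (κ near 1/8): Re
det_AP[R_c U] ≤ Re det_AP[𝟙] — among period-2 reflection tilings the flat cell (all 24 cell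
plaquettes trivial; with the antiperiodic twist this is the flat connection with holonomy −1 on
every cycle) maximises the Wilson–Dirac determinant. Toy evidence (card, kit j000423, Bloch form at
κ = 0.125, SU(3)): φ_flat = −0.1359 against ≤ −0.005 for 300 Haar cells and all ascents; leading
order: the plaquette term of log det has spin trace tr[(1−γ_μ)(1−γ_ν)(1+γ_μ)(1+γ_ν)] = −8 < 0
(screening sign), so flat wins at O(κ⁴). [difficulty: L] (why it might fail: Lieb's theorem itself:
for NAIVE/half-filled hopping the π-flux cell beats flux 0 (Lieb1994, LiebLoss1993); U(1) π-flux
cells embed in U(3), so if the Wilson term at κ ≈ 1/8 does not flip the optimum — or flips it only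
in the Bloch (L → ∞) average and not at L = 4 — K is false while C survives.) [Lieb1994,
LiebLoss1993, arXiv:cond-mat/9410025, arXiv:cond-mat/9209031, MontvayMunster1994 §5.1.3 (5.36),
kit:j000423 (card toy)]
#4 BackgroundSchwarz (support, rank 4) — (card P1, the background Schwarz inequality S, time
direction, site planes t = 0 and t = L/2) for all N, all even L ≥ 4, every U(N) field U and m > −1:
with H the closed positive half (temporal links (x,0) with x₀ < L/2, spatial links (x,j), j ≠ 0,
with x₀ ≤ L/2; = WilsonSiteRP.sitePosEdges ∪ sharedEdges) and Θ' the site reflection x₀ ↦ −x₀ on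
link fields (temporal links reversed and inverted; = GaugeConfig.negReflect), both INLINED in the
Lean term since rev 2, the positive double U⁺⁺ = (H ? U : Θ'U) and the negative double U⁻⁻ = (H ?
Θ'U : U) have real non-negative det_AP, and ‖det_AP[U]‖² ≤ Re det_AP[U⁺⁺] · Re det_AP[U⁻⁻]. Proof
route: Lüscher's ξ/η split (MontvayMunster1994 (4.100)–(4.106)) makes det_AP[U] = B_(U₀)(𝓘_(U₊),
𝓘_(θU₋)) with B_(U₀) positive semidefinite once 1 − 6κ > 0 ((4.109)–(4.111)); Cauchy–Schwarz. All
other axes and translates follow by lattice symmetries (det_AP is a class function of the field: the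
twist slice moves by a centre gauge transformation). [difficulty: M] (why it might fail: the
PERIODIC analogue fails numerically (card kit j000360, margin −6 at κ = 0.125): all hinges on the
antiperiodic sector and the exact r = 1 projector split; a slip in which half owns the in-plane
links, or B(U₀) ≥ 1 − 6κ failing for U(N) in-plane links, kills S as stated.) [Luscher1977,
OsterwalderSeilerAnnPhys1978, MontvayMunster1994 §4.2.3 (4.99)–(4.111), Lieb1994 eq. (6),
KennedyLieb1986, Seiler1982 Ch. 3, kit:j000305, kit:j000360]
#5 DominationBridge (support since the re-type repair of 2026-08-16; was the rank-5 crux) — the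
ONE-SHOT bridge QuarkChessboard → FlatCellOptimal → `QCD`. It names the Statement decl, so after
p117723 it silently demands `reg.IsChiralAtZero` of the regularisation it constructs; to keep the
new conjunct visible it is now the composite of #6 MassiveBridge and #7 ChiralDescent (glue `fun hM
hD hC hK => hD (hM hC hK)`, Sketch.lean `dominationBridge_of_split`, rc 0), kept as a support decl
because the item Assembly quotes it and as the one-shot form a prover may still close directly.
[deps: QuarkChessboard, FlatCellOptimal] [difficulty: open-problem] [Balaban1989LargeFieldII,
JaffeWitten2000 §5]
#6 MassiveBridge (crux, rank 6) — (card K2 + the rest of the MASSIVE construction; the engine's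
customer up to the PRE-RETYPE statement) QuarkChessboard → FlatCellOptimal → threshold-massive QCD:
given the pathwise local domination |Π_f det_AP D_W[U, m_f]| ≤ e^(−Σ_f Σ_c φ_c(U, m_f)) with φ_c ≥
φ_flat for U(3) ⊃ SU(3) fields at bare masses near 0, construct for N_f = 2, 3 an offset M₀ ≥ 0 and
a mass-independent regularisation with HasMassScaling along which, for EVERY mass tuple m_f > M₀,
(i) a Bałaban-type block RG with dynamical Wilson quarks is UV-stable — large-field regions Z
suppressed by the Wilson action alone, the quark weight contributing at most its flat bulk value on
Z (C ∧ K), small fields by fermionic cluster expansions (BOS technology) with m_crit(k) tuned inside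
the flow — giving IsQCDAlong along a subsequence (the Statement asks existence along a SEQUENCE),
non-trivial non-Gaussian glue and non-decoupled flavoured pseudoscalars, and (ii) the SU(3) +
massive-quark infrared (uniform lattice gap, clustering, OS reconstruction) gives one Δ > 0 with
T.HasMassGap Δ ∧ HasLatticeMassGap Δ. The conclusion is verbatim the right-hand side of the old
`qcdOf_iff_threshold` (∀ N_f ∈ {2,3}, ∃ M₀ ≥ 0, ∃ reg, HasMassScaling ∧ ∀ m > M₀, body), i.e. `QCD`
as it read before p117723, equivalent to the offset-free old body by the m_crit shift (Sketch.lean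
`offsetFree_of_threshold`); the offset is FREE here because the additive Wilson mass renormalisation
need only be controlled to O(aΛ). [deps: QuarkChessboard, FlatCellOptimal] [difficulty:
open-problem] (why it might fail: constructive MASSIVE QCD minus one input: no block RG with a
DYNAMICAL non-abelian field + Wilson quarks exists in d = 4 (Bałaban: pure YM; BOS: external field;
Dimock: QED₃); RG steps need local det RATIOS, C gives an upper bound only; N_f = 3 sign
normalisation; the volume-uniform SU(3) gap above any offset is Millennium-grade, and even heavy
renormalised masses sit at near-critical BARE masses, so no hopping expansion converges uniformly.)
[Balaban1989LargeFieldII, Balaban1988Convergent, BalabanOcarrollSchor1989, Dimock2022QED3,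
BrydgesFrohlichSeiler1979, JaffeWitten2000 §5,
Literature.Barriers.QuantumFields.UVStabilityNonUniqueness,
Literature.Barriers.QuantumFields.HoppingExpansionUniformGap, stmt-QuantumFields-8695
(DynamicalQuarkContinuum: the shared UV half)]
#7 ChiralDescent (crux, rank 7) — (the conjunct `reg.IsChiralAtZero` added by the statement re-type
p117723, isolated) threshold-massive QCD → `QCD`: if for N_f = 2, 3 massive QCD with all the
properties above exists for every mass tuple above SOME flavour-blind offset, then it exists for a
regularisation whose offset is pinned at the chiral point — for every ε > 0 some positive tuple m
has no uniform lattice gap ε for reg.scheme m 0 0, i.e. the lattice gap closes in physical units as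
m → 0⁺ — with HasMassScaling and the full body for ALL m > 0. Physics imported: massless N_f ≥ 2 QCD
is gapless (Goldstone pions, m_π² ∝ m_q — GellmannOakesRenner1968, GasserLeutwyler1984; or massless
fermions by anomaly matching if chiral symmetry were unbroken — tHooft1980Naturalness; the critical
line is 'where the renormalized quark mass, and due to the Goldstone theorem, also the pion mass,
vanishes', MontvayMunster1994 PDF p. 239, (5.59)–(5.60)); for Wilson fermions the descent runs into
the Aoki / Sharpe–Singleton critical region (Aoki1984WilsonPhase, SharpeSingleton1998: at fixed
spacing the charged-pion mass is zero on a phase boundary or bounded below by O(aΛ²)), which the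
clause tolerates because HasLatticeMassGap is uniform in k in physical units. Ranked last:
hardest-but-least-specific to this line; its hypothesis is implied by `QCD` (Sketch.lean
`threshold_of_qcd`), so it is weaker than the Statement, not a restatement, and it REPLACES the
former third bridge step 'GapAboveThreshold + threshold shift of qcdOf_iff_threshold', whose ← half
is false since the re-type (docs/m5/audits/retype-2026-08-16/qcd/REPORT.md). [deps: none]
[difficulty: open-problem] (why it might fail: an ∃-hypothesis carries no machinery below its
offset: descent to m → 0⁺ is the whole light-quark construction; in the first-order scenario m_π ≥
c·aΛ² at fixed a, so the gap closes only jointly in m → 0⁺, k → ∞ — the quantifier order of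
IsChiralAtZero/HasLatticeMassGap is load-bearing.) [GellmannOakesRenner1968, GasserLeutwyler1984,
tHooft1980Naturalness, SharpeSingleton1998, Aoki1984WilsonPhase, BanksCasher1980, MontvayMunster1994
§5.1, JaffeWitten2000 §1 (3) and §5]
#9 QuarkDiamagnetism (support) — (sharp global corollary; the diamagnetic inequality for Wilson
quarks, lattice form of the Hogreve–Schrader–Seiler question) there is δ > 0 such that for all N,
even L ≥ 4, every U(N) field U and m ∈ (−δ, δ): ‖det_AP D_W[U]‖ ≤ Re det_AP D_W[𝟙]. Glue: from
QuarkChessboard and FlatCellOptimal by 0 ≤ Re det_AP[R_c U] ≤ Re det_AP[𝟙] for every cell and the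
L⁴-th root (provable now GIVEN ranks 2 and 3); filed so that one explicit configuration beating the
free antiperiodic determinant refutes C ∧ K at once. [difficulty: M] [BrydgesFrohlichSeiler1979,
Seiler1982, arXiv:hep-th/9611055 (Fry: no such bound survives renormalisation in d = 4 — harmless
for the unrenormalised lattice det), Lieb1994]

TWO-LAYER PLAN. Foreseen glued splits (k ≤ 3, depth 1; nothing filed now): QuarkChessboard ⇐
BackgroundSchwarz (already an item, PROVED) → AxisTransport → ChessboardIteration → QuarkChessboard
— DONE: C is proved
(…Cruxes.CriticalLineDiamagnetism.ChessboardCellGain.stub_quarkChessboard_of_schwarz, p112660; proof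
@ b37869be232f). FlatCellOptimal ⇐ LocalFlatOptimum (second variation at the flat cell = one-loop
vacuum polarisation at period-2 momenta, screening sign; card P3) → FarFromFlat (symmetry-reduced
interval arithmetic / Hadamard bounds on the 64N-dimensional Bloch blocks at the 2⁴ antiperiodic
momenta of each L) → FlatCellOptimal. MassiveBridge ⇐ ConditionalDomination (S/C with
reflection-symmetric insertions, Lieb1994 eq. (7): ratio form usable inside one block step) →
DominationUV (C → K → the shared UV half `DynamicalQuarkContinuum`, stmt-QuantumFields-8695 of route
RenormalisedVafaWitten) → MassiveInfrared (SU(3) + massive-quark infrared for the witness above its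
own offset M₀; NO threshold shift is needed or available any more — the ← half of
`qcdOf_iff_threshold` is false since the re-type, which is exactly why the conclusion of
MassiveBridge is stated in threshold form) → MassiveBridge. ChiralDescent ⇐ LightQuarkWindow (the
massive construction continued down to m → 0⁺ relative to the Ward-identity critical line, uniform
lattice gap Δ(m) > 0 for every m > 0) → GapClosing (Δ_lattice(m) → 0 as m → 0⁺ in the form
IsChiralAtZero: GMOR / Goldstone, or anomaly matching; must tolerate the Sharpe–Singleton
first-order scenario) → ChiralDescent; both children would be shared in substance with the chiral
routes and are to be filed only if MassiveBridge moves. The one-shot DominationBridge (support) =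
MassiveBridge → ChiralDescent → DominationBridge by logic (Sketch.lean `dominationBridge_of_split`).

KILL CRITERIA. One explicit configuration violating BackgroundSchwarz (any N, any even L ≥ 4, m >
−1) refutes S and with it the only known road to C: close `refuted:BackgroundSchwarz` unless C
survives numerically (then pivot C to "Schwarz in the mean"). A refutation of QuarkChessboard closes
the route outright (`refuted:QuarkChessboard`). A refutation of FlatCellOptimal (a period-2 cell
beating the flat one near κ = 1/8, e.g. an embedded U(1) π-flux cell) kills the sharp corollary and
QuarkDiamagnetism but NOT the engine: pivot K to "the optimal cell value φ_* (whatever it is)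
replaces φ_flat" — the bridge only needs a U-independent cell bound — via `--restate
FlatCellOptimal`. If DynamicalQuarkContinuum (stmt-QuantumFields-8695) or any full QCD construction
lands elsewhere without a large-field fermion input, the route is moot (close superseded). If a
block-RG analysis shows the large-field fermion factor must be controlled as a RATIO
det[U]/det[U_smallfield] with locality that C cannot give, MassiveBridge is mis-posed: pivot to the
conditional-insertion form (two-layer plan) or retire. ChiralDescent cannot be refuted short of ¬QCD
(its hypothesis is the pre-retype statement, its conclusion the Statement): it is closed, not killed
— if a chiral route (AnomalyRigidity, ChiralSpinWaves, EulerDescent) lands a theorem of the shape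
threshold-massive → chiral-at-zero, re-file D over that fact or close it by the theorem; if the
Statement's chiral clause is revised again, D (and the support DominationBridge, by name) are the
only items that move.

NOT DECOMPOSED YET. The transfer between the tree's time-PERIODIC `wilsonDirac` on ODD tori 2L_k+1
(the scheme's `side`, `qcdTorusExpect` = (−1)^F-twisted trace) and the even-torus antiperiodic
determinants of C/K/S (centre twists are U(3)- not SU(3)-valued: exactly why the engine is stated
over U(N)); the conditional/ratio version of C with insertions needed inside a block step (card K2);
the Bloch-integral (L → ∞) form φ_κ(u) = −∫ log|det Q̂_u(k)| dk of the cell functional and its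
uniformity in u; mass-split flavours (masses enter cell-wise, nothing to add); everything infrared
above the offset (MassiveInfrared); the light-quark / chiral regime (LightQuarkWindow, GapClosing).
All are layer-2 children of MassiveBridge or ChiralDescent (QuarkChessboard's are done), to be filed
only after K closes or MassiveBridge moves.

CHEAPEST FALSIFIER. A 4⁴ computation (minutes): Haar-random U(1), SU(3) and U(3) link fields, m ∈
{0, −0.5, −0.9} (κ = 1/8, 1/7, 1/6.2), antiperiodic twist on the slice x_i = 3 of every axis: (a) S:
2 log‖det D[U]‖ ≤ log Re det D[U⁺⁺] + log Re det D[U⁻⁻] with the doubles built from the inlined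
closed half H of the Lean term (= `sitePosEdges ∪ sharedEdges`) (the card's kit j000305/j000360
passed the time-antiperiodic version with margins 2.8–28 and showed the periodic control FAILS, so
the test is sharp); (b) C directly at L = 4: 256 log‖det D[U]‖ ≤ Σ_(256 cells) log Re det D[R_c U] —
never run; (c) K at L = 4, m = 0: det D[R_c U] for the U(1) π-flux cell (phases giving flux π
through every plaquette of one orientation class) and for 10³ random cells against det D[𝟙]. Any
single violation of (a) or (b) kills the line; (c) kills only K/QuarkDiamagnetism. Not run by this
planner (plancard seat, no kit budget requested); refuters first.

NUMBERS. κ = 1/(2m + 8) for the tree's `wilsonDirac ρ U m 1`: m > −1 ⟺ κ < 1/6 (site-RP range,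
MontvayMunster1994 (4.111)); m = 0 ⟺ κ = 1/8 (free critical point; the scaling sequence has m_f(k) →
0). Cell = closed unit hypercube: 16 sites, 32 links, 24 plaquettes; each link lies in 8 cells; L⁴
cells; exponent 1/L⁴; at side L the tiling's determinant factorises over 2⁴ = 16 Bloch momenta with
blocks of size 64N (192 for N = 3). Card toys (SU(3), 4⁴): S holds with log-margins 2.8, 7.4, 17,
23, 28 at κ = 0.10, 0.125, 0.15, 0.16, 0.1666 (time-antiperiodic), periodic control margin −6 at κ =
0.125; K (Bloch form, κ = 0.125): φ_flat = −0.1359, 300 Haar cells in [−0.027, −0.005], ascents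
plateau ≥ −0.062. Leading hopping-expansion coefficient: spin trace −8 at O(κ⁴). Items at open: 6 (4
cruxes, 1 support, 1 assembly); after retriage 2026-08-15: 3 cruxes / 2 supports; after the re-type
repair 2026-08-16: 8 items — cruxes QuarkChessboard (proved), FlatCellOptimal, MassiveBridge,
ChiralDescent; supports BackgroundSchwarz (proved), DominationBridge, QuarkDiamagnetism; Assembly.

DEFINITION REQUESTS. To be filed after open (new objects for this problem, topic
Summits/QuantumFields/QCD/Theorems): `apWilsonDet N L U m` (the all-axes antiperiodic Wilson–Dirac
determinant of a U(N) field, = det wilsonDirac (unitaryFundamentalRep) (twist U) m 1) and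
`cellReflectionTiling c U` (the period-2 site-reflection tiling R_c U); both are inlined verbatim in
the items above, so nothing waits on them. Cite fact wanted (not load-bearing): Lüscher 1977 /
MontvayMunster1994 (4.109)–(4.111) positivity of the Wilson-fermion site-RP form for 6κ < 1 as a
Literature fact over `wilsonDirac` (it is the r = 1, symmetric-background case of
BackgroundSchwarz).

Novelty: Searches (2026-08-15, this seat): `lit search --hybrid "reflection positivity Schwarz inequality
fermion determinant gauge background chessboard"` (15 held docs: Fröhlich–Lieb 1978 / FILS in
book:liebnd-statistical-mechanics pp. 126–135 — read pp. 251–253 of the reprint, Thm 2.2 + Lemma;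
MontvayMunster1994 pp. 180–185; nothing on determinants at asymmetric backgrounds); `lit galaxy
search "paramagnetic inequality" --star all` (4 rows: Duke (ed.) Advances in Lattice Gauge Theory
1985, ICHEP XXIII, LNP 116 (Lausanne 1979) — the Hogreve–Schrader–Seiler/BFS paramagnetic-inequality
context, continuum QED₂,₃ only; pdf: De Angelis–Jona-Lasinio–Sidoravicius cond-mat/9709053, Berezin
integrals via Poisson processes, unrelated); `lit galaxy search "diamagnetic inequality for
fermions" | "determinant is maximized by the flux" --star all` (0 rows each); `lit search --source
arxiv …` and `--source all` unavailable at filing (rc 3/75, logged); `lean search` over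
Summits/QuantumFields (9 QCD routes open today: RenormalisedVafaWitten, HeavyThreshold(YM)Bridge,
OverlapPositivityTransfer, FemtoStepScaling, FourMirrorsWardE1, HeatSlicedQuarks, SeaNonGibbs — none
uses RP at an asymmetric background, a chessboard bound, or any pathwise determinant domination);
`ledger negatives --problem QuantumFields` (0). Plus the card's searches (lit search "Lieb flux
phase" arXiv 15 rows; "reflection positivity lattice fermions" arXiv 15 rows surfacing Goller–Porta;
frontier/bridges 30+30; galaxy "flux phase  [refs: 2501.10065, cond-mat/9410025, cond-mat/9209031, hep-th/9611055, book:liebnd-statistical-mechanics, MontvayMunster1994, Lieb1994, LiebLoss1993, KennedyLieb1986, Luscher1977, BrydgesFrohlichSeiler1979]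

Barriers (technique_class: reflection-positivity, chessboard, det-inequality): - technique_class: reflection-positivity, chessboard, det-inequality
- Literature.Barriers.QuantumFields.HoppingExpansionUniformGap: evaded — nothing is expanded in κ; S
and C are claimed on the whole site-RP range 6κ < 1 ⊃ the scaling window κ → 1/8, where the
expansion's uniform disc |κ| < 1/(16√3) is useless.
- Literature.Barriers.QuantumFields.HoppingExpansionLocality: evaded the same way — the locality
obtained is of the effective ACTION (cell functional Σ_c φ_c), not of the propagator, and does not
degrade at κ = 1/8; the barrier's ℓ²-disc κ < 1/8 is exactly where K's window sits, but K is a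
variational statement, not a Neumann series.
- Literature.Barriers.QuantumFields.WilsonDeterminantSign: evaded — only |det| is bounded, and every
comparison determinant (doubles, tilings, free AP) lives on a reflection-symmetric background where
it is B(F,F) ≥ 0 flavour by flavour; odd N_f = 3 needs no sign information for the domination (the
normalisation ⟨sign⟩ stays inside DominationBridge, conceded).
- Literature.Barriers.QuantumFields.WilsonDeterminantMassSplitting: same evasion; masses enter
flavour by flavour and cell by cell, split masses change nothing in S/C/K.
- Literature.Barriers.QuantumFields.VafaWittenEigenvalueBound: not engaged — no spectral gap of any
Dirac operator is claimed; near-zero modes of rough fields only make |det| smaller, which is the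
direction of C.
- Literature.Barriers.QuantumFields.UVStabilityNonUniqueness: applies to DominationBridge (i) and is
met

History (route lifecycle, newest last):
- 2026-08-15T16:11:53Z · rev 2: restated BackgroundSchwarz (stmt-QuantumFields-9308) — cone repair (route-repair g2): the route's only extra import Literature.MathematicalPhysics.QuantumFieldTheory.ConstructiveQFTWave0SiteRPProofs pulls in Constru (planner-rrepair-QuantumFields-WilsonQuarkChess-4a1460bc-g2-0)
- 2026-08-16T19:39:04Z · rev 5: restated Assembly (stmt-QuantumFields-9311 proved) — route-repair (ground-failed, rground 4a1460bc): the only blocking ground flag (payload.ground ts 2026-08-16T19:26:27Z) was Assembly (stmt-QuantumFields-9311, pr (planner-rground-QuantumFields-WilsonQuarkChessb-4a1460bc-0)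
- 2026-08-26T05:43:59Z · DORMANT — reconciler: no traction for 8.4 d (last activity statement-closed at 2026-08-17T19:58:36Z); parked, not closed — `ledger route dormant route-QuantumFields-Wilso (operator:999:860200)

sub-problem: QCD · status: dormant · opened planner-plancard-QuantumFields-QCD-wilson-det-1b4cf14e-0 2026-08-15T13:55:38Z · rev 7 · ledger route-QuantumFields-WilsonQuarkChessboard
GENERATED by the gate from the ledger (D-0016/17). Provers cite these decls: `theorem foo : Summit.QuantumFields.QCD.Theses.WilsonQuarkChessboard.<Decl> := …` in Summits/QuantumFields/QCD/Theorems/<Name>.lean.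
-/

namespace Summit.QuantumFields.QCD.Theses.WilsonQuarkChessboard

open scoped BigOperators Topology Manifold Classical MeasureTheory ProbabilityTheory Matrix InnerProductSpace ComplexConjugate ContinuousMap
open Filter Set Function TopologicalSpace MeasureTheory

attribute [summit_statement] _root_.QCD

/-- item stmt-QuantumFields-9306 · crux · rank 2 · closed · proved by Summit.QuantumFields.QCD.Theorems.wilsonQuarkChessboardQuarkChessboard_proof @ b37869be232f (prover) · by planner
why it might fail: Fröhlich–Lieb's Lemma (z=1)/FILS Thm 4.1 need a functional MULTILINEAR in INDEPENDENT slots; F=|det| is nonlinear and closed cells share face links (8 cells/link): the maximiser must run over a doubling-closed class of gauge fields with ratio normalisation — unrecorded; C is untested numerically.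
sources: FrohlichLieb1978 Thm 2.2 + Lemma (book:liebnd-statistical-mechanics PDF pp. 133–134 = printed 251–252), FrohlichIsraelLiebSimon1978 Thm 4.1, Biskup2009 (arXiv:math-ph/0610025) §5, LiebLoss1993 (arXiv:cond-mat/9209031), Lieb1994 (arXiv:cond-mat/9410025), arXiv:2501.10065
[crux] (card item (C), with K3's bookkeeping inside) for all N, all even L ≥ 4, every U :
GaugeConfig 4 L U(N) and every m > −1: writing det_AP[V] := det wilsonDirac (unitary fundamental
rep) (V with the links (x,i), x_i = L−1, multiplied by −1) m 1 (antiperiodic b.c. in all four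
directions) and R_c U for the period-2 reflection tiling of the torus by the closed unit cell with
lowest corner c (link (x,j) ↦ U(fold x, j) if x_j − c_j is even, (U(fold(x+e_j), j))⁻¹ if odd, fold
y = c + ((y − c) mod 2)), every det_AP[R_c U] is real and ≥ 0 and ‖det_AP[U]‖^(L⁴) ≤ Π_(c : Site 4
L) Re det_AP[R_c U]. [deps: BackgroundSchwarz] [difficulty: L] -/
@[route_item "route-QuantumFields-WilsonQuarkChessboard", crux]
def QuarkChessboard : Prop :=
  ∀ (N L : ℕ) [NeZero L], Even L → 4 ≤ L → ∀ (U : Literature.MathematicalPhysics.QuantumFieldTheory.GaugeConfig 4 L (Matrix.unitaryGroup (Fin N) ℂ)) (m : ℝ), -1 < m → let dAP : Literature.MathematicalPhysics.QuantumFieldTheory.GaugeConfig 4 L (Matrix.unitaryGroup (Fin N) ℂ) → ℂ := fun V => (Literature.MathematicalPhysics.QuantumLattice.wilsonDirac (Literature.MathematicalPhysics.QuantumLattice.unitaryFundamentalRep (Fin N) ℂ) (fun e => if (e.1 e.2).val + 1 = L then -V e else V e) m 1).det; let tile : Literature.MathematicalPhysics.QuantumFieldTheory.Site 4 L → Literature.MathematicalPhysics.QuantumFieldTheory.GaugeConfig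 4 L (Matrix.unitaryGroup (Fin N) ℂ) → Literature.MathematicalPhysics.QuantumFieldTheory.GaugeConfig 4 L (Matrix.unitaryGroup (Fin N) ℂ) := fun c V e => if (e.1 e.2 - c e.2).val % 2 = 0 then V (fun ν => c ν + (((e.1 ν - c ν).val % 2 : ℕ) : ZMod L), e.2) else (V (fun ν => c ν + (((Literature.MathematicalPhysics.QuantumFieldTheory.Site.shift e.1 e.2 ν - c ν).val % 2 : ℕ) : ZMod L), e.2))⁻¹; (∀ c, 0 ≤ (dAP (tile c U)).re ∧ (dAP (tile c U)).im = 0) ∧ ‖dAP U‖ ^ (L ^ 4) ≤ ∏ c : Literature.MathematicalPhysics.QuantumFieldTheory.Site 4 L, (dAP (tile c U)).re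

-- `QuarkChessboard` holds: proved by `Summit.QuantumFields.QCD.Theorems.wilsonQuarkChessboardQuarkChessboard_proof` @ b37869be232f (its module imports this route file, so no `_holds` link can be stated here).

/-- item stmt-QuantumFields-9307 · crux · rank 3 · closed · proved by Summit.QuantumFields.QCD.Theorems.wilsonQuarkChessboardFlatCellOptimal_proof @ 706caa8bf5b7 (prover) · by planner
why it might fail: Lieb1994/LiebLoss1993: for naive half-filled hopping the π-flux cell MAXIMISES |det|, flux 0 does not; U(1) π-flux cells embed in U(N). K bets the r=1 Wilson term flips the optimum near κ=1/8 with ONE δ uniform in N, L and two-sided in m; evidence: a 300-sample SU(3) Bloch toy only (kit:j000423).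
sources: Lieb1994 (arXiv:cond-mat/9410025) Thm + eq. (6), LiebLoss1993 (arXiv:cond-mat/9209031), MontvayMunster1994 §5.1.3 (5.36), kit:j000423
[crux] (card K1, finite-volume form) there is δ > 0 such that for all N, all even L ≥ 4, every U(N)
field U, every cell c and every bare mass m ∈ (−δ, δ) (κ near 1/8): Re det_AP[R_c U] ≤ Re det_AP[𝟙]
— among period-2 reflection tilings the flat cell (all 24 cell plaquettes trivial; with the
antiperiodic twist this is the flat connection with holonomy −1 on every cycle) maximises the
Wilson–Dirac determinant. Toy evidence (card, kit j000423, Bloch form at κ = 0.125, SU(3)): φ_flat =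
−0.1359 against ≤ −0.005 for 300 Haar cells and all ascents; leading order: the plaquette term of
log det has spin trace tr[(1−γ_μ)(1−γ_ν)(1+γ_μ)(1+γ_ν)] = −8 < 0 (screening sign), so flat wins at
O(κ⁴). [difficulty: L] -/
@[route_item "route-QuantumFields-WilsonQuarkChessboard", crux (experiment := "instrument: kit jobs cited as sources kit:j000423") (source := "ledger wanted_by.sources on stmt-QuantumFields-9307, 2026-09-01")]
def FlatCellOptimal : Prop :=
  ∃ δ : ℝ, 0 < δ ∧ ∀ (N L : ℕ) [NeZero L], Even L → 4 ≤ L → ∀ (U : Literature.MathematicalPhysics.QuantumFieldTheory.GaugeConfig 4 L (Matrix.unitaryGroup (Fin N) ℂ)) (c : Literature.MathematicalPhysics.QuantumFieldTheory.Site 4 L) (m : ℝ), -δ < m → m < δ → let dAP : Literature.MathematicalPhysics.QuantumFieldTheory.GaugeConfig 4 L (Matrix.unitaryGroup (Fin N) ℂ) → ℂ := fun V => (Literature.MathematicalPhysics.QuantumLattice.wilsonDirac (Literature.MathematicalPhysics.QuantumLattice.unitaryFundamentalRep (Fin N) ℂ) (fun e => if (e.1 e.2).val + 1 = L then -V e else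 V e) m 1).det; let tile : Literature.MathematicalPhysics.QuantumFieldTheory.Site 4 L → Literature.MathematicalPhysics.QuantumFieldTheory.GaugeConfig 4 L (Matrix.unitaryGroup (Fin N) ℂ) → Literature.MathematicalPhysics.QuantumFieldTheory.GaugeConfig 4 L (Matrix.unitaryGroup (Fin N) ℂ) := fun c V e => if (e.1 e.2 - c e.2).val % 2 = 0 then V (fun ν => c ν + (((e.1 ν - c ν).val % 2 : ℕ) : ZMod L), e.2) else (V (fun ν => c ν + (((Literature.MathematicalPhysics.QuantumFieldTheory.Site.shift e.1 e.2 ν - c ν).val % 2 : ℕ) : ZMod L), e.2))⁻¹; (dAP (tile c U)).re ≤ (dAP 1).re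

-- `FlatCellOptimal` holds: proved by `Summit.QuantumFields.QCD.Theorems.wilsonQuarkChessboardFlatCellOptimal_proof` @ 706caa8bf5b7 (its module imports this route file, so no `_holds` link can be stated here).

/-- item stmt-QuantumFields-17577 · crux · rank 6 · open · by planner
why it might fail: Constructive MASSIVE QCD minus one input: no block RG with a DYNAMICAL non-abelian field + Wilson quarks exists in d=4 (Bałaban: pure YM; BOS: external field; Dimock: QED₃); RG steps need local det RATIOS, C gives an upper bound only; N_f=3 sign; volume-uniform SU(3) gap above any offset.
sources: Balaban1989LargeFieldII, Balaban1988Convergent, BalabanOcarrollSchor1989, Dimock2022QED3, JaffeWitten2000 §5, Literature.Barriers.QuantumFields.UVStabilityNonUniqueness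
[crux] (child 1 of DominationBridge = the engine's customer up to the PRE-RETYPE statement,
threshold form) QuarkChessboard → FlatCellOptimal → massive QCD above an unpinned flavour-blind
offset: for N_f = 2 and N_f = 3 there are M₀ ≥ 0 and a mass-independent regularisation reg with
HasMassScaling such that for EVERY mass tuple with m_f > M₀, along m_f(k) = m_crit(k) + a_k
m_f/Z_m(k) (some species renormalisations z, shift), there are OS data T with IsQCDAlong,
non-trivial non-Gaussian glue, non-decoupled flavour-changing pseudoscalars and one Δ > 0 with
T.HasMassGap Δ ∧ HasLatticeMassGap Δ — verbatim the right-hand side of the old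
`qcdOf_iff_threshold`, i.e. the statement `QCD` as it read before p117723 (equivalent by the shift
m_crit ↦ m_crit + a_k M₀/Z_m(k); Sketch.lean offsetFree_of_threshold, rc 0). Content as before: (i)
a Bałaban-type block RG with dynamical Wilson quarks, large-field regions suppressed by the Wilson
action alone with the quark weight at most its flat bulk value there (C ∧ K), small fields by
fermionic cluster expansions with m_crit(k) tuned inside the flow, giving IsQCDAlong along a
subsequence; (ii) the SU(3) + massive-quark infrared (volume-uniform lattic -/
@[route_item "route-QuantumFields-WilsonQuarkChessboard", crux]
def MassiveBridge : Prop :=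
  QuarkChessboard → FlatCellOptimal → ∀ Nf : ℕ, Nf = 2 ∨ Nf = 3 → ∃ M₀ : ℝ, 0 ≤ M₀ ∧ ∃ reg : Literature.MathematicalPhysics.QuantumFieldTheory.QCDRegularisation Nf, reg.HasMassScaling ∧ ∀ m : Fin Nf → ℝ, (∀ f, M₀ < m f) → ∃ (z shift : Literature.MathematicalPhysics.QuantumFieldTheory.QCDField Nf → ℕ → ℝ) (T : Literature.MathematicalPhysics.QuantumFieldTheory.OSData (Literature.MathematicalPhysics.QuantumFieldTheory.QCDField Nf) 4), Literature.MathematicalPhysics.QuantumFieldTheory.IsQCDAlong (reg.scheme m z shift) T ∧ T.IsNontrivial Literature.MathematicalPhysics.QuantumFieldTheory.QCDField.glue ∧ T.IsNonGaussian Literature.MathematicalPhysics.QuantumFieldTheory.QCDField.glue ∧ (∀ f g : Fin Nf, f ≠ g → T.IsNontrivial (Literature.MathematicalPhysics.QuantumFieldTheory.QCDField.pseudoRe f g)) ∧ ∃ Δ > 0, T.HasMassGap Δ ∧ (reg.scheme m z shift).HasLatticeMassGap Δ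

/-- item stmt-QuantumFields-17578 · crux · rank 7 · open · by planner
why it might fail: An ∃-hypothesis carries no machinery below its offset: descent to m→0⁺ is the whole light-quark construction; for Wilson quarks the chiral point lies in the Aoki/Sharpe–Singleton region (1st order: m_π ≥ c·aΛ² at fixed a): the gap closes only jointly in m→0⁺, k→∞; quantifier order load-bearing.
sources: GellmannOakesRenner1968, GasserLeutwyler1984, tHooft1980Naturalness, SharpeSingleton1998, Aoki1984WilsonPhase, BanksCasher1980
[crux] (child 2 of DominationBridge = the conjunct `reg.IsChiralAtZero` added by the statement
re-type p117723, isolated) threshold-massive QCD → `QCD`: if for N_f = 2, 3 massive QCD with all the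
properties of child 1 exists for every mass tuple above SOME flavour-blind offset M₀ ≥ 0, then it
exists for a regularisation whose offset is pinned at the chiral point — reg.IsChiralAtZero: for
every ε > 0 some positive tuple m has NO uniform lattice gap ε for reg.scheme m 0 0, i.e. the
lattice gap closes in physical units as m → 0⁺ — together with HasMassScaling and the full body for
ALL m > 0. Physics imported (foreign to the determinant-domination engine, which suppresses
near-zero Dirac modes and says nothing about light pions): massless N_f ≥ 2 QCD is gapless —
Goldstone pions with m_π² ∝ m_q (GMOR) if chiral symmetry breaks, massless fermions by 't Hooft
anomaly matching if it does not; the critical line is 'where the renormalized quark mass, and due to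
the Goldstone theorem, also the pion mass, vanishes' (MontvayMunster1994 PDF p. 239, (5.59)–(5.60)).
For Wilson fermions the descent runs into the Aoki / Sharpe–Singleton critical region: at fixed
spacing the charged-pion mass is eit -/
@[route_item "route-QuantumFields-WilsonQuarkChessboard", crux]
def ChiralDescent : Prop :=
  (∀ Nf : ℕ, Nf = 2 ∨ Nf = 3 → ∃ M₀ : ℝ, 0 ≤ M₀ ∧ ∃ reg : Literature.MathematicalPhysics.QuantumFieldTheory.QCDRegularisation Nf, reg.HasMassScaling ∧ ∀ m : Fin Nf → ℝ, (∀ f, M₀ < m f) → ∃ (z shift : Literature.MathematicalPhysics.QuantumFieldTheory.QCDField Nf → ℕ → ℝ) (T : Literature.MathematicalPhysics.QuantumFieldTheory.OSData (Literature.MathematicalPhysics.QuantumFieldTheory.QCDField Nf) 4), Literature.MathematicalPhysics.QuantumFieldTheory.IsQCDAlong (reg.scheme m z shift) T ∧ T.IsNontrivial Literature.MathematicalPhysics.QuantumFieldTheory.QCDField.glue ∧ T.IsNonGaussian Literature.MathematicalPhysics.QuantumFieldTheory.QCDField.glue ∧ (∀ f g : Fin Nf, f ≠ g → T.IsNontrivial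 (Literature.MathematicalPhysics.QuantumFieldTheory.QCDField.pseudoRe f g)) ∧ ∃ Δ > 0, T.HasMassGap Δ ∧ (reg.scheme m z shift).HasLatticeMassGap Δ) → QCD

-- earlier BackgroundSchwarz (stmt-QuantumFields-9308, replaced 2026-08-15T16:11:53Z -> stmt-QuantumFields-10349): retired by None — ∀ (N L : ℕ) [NeZero L], Even L → 4 ≤ L → ∀ (U : Literature.MathematicalPhysics.QuantumFieldTheory.GaugeConfig 4 L (Matrix.unitaryGroup (Fin N) ℂ)) (m : ℝ), -1 < m → let dAP : Literature.MathematicalPhysics.QuantumFieldTheory.GaugeConfig 4 L (Matrix.unitaryGroup (Fin N) 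
/-- item stmt-QuantumFields-10349 · support · rank 4 · closed · proved by Summit.QuantumFields.QCD.Cruxes.CriticalLineDiamagnetism.ChessboardCellGain.stub_backgroundSchwarz @ 2722fd865c09 (prover) · by planner
why it might fail: none found: conventions in the Lean term check (closed half P′∪M kept, negReflect sign-free, AP twist = plain trace, spatial twists commute with Θ′); B[U₀]>0 iff 6κ<1 iff m>−1 holds for any unitary in-plane links; toy kit:j000305 passed it as stated.
sources: Luscher1977, OsterwalderSeilerAnnPhys1978 §2, MontvayMunster1994 §4.2.3 (4.99)–(4.111) (book:montvay1994-quantum-fields-lattice pp. 182–184), Lieb1994 eq. (6), KennedyLieb1986, kit:j000305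
[crux] (card P1, the background Schwarz inequality S, time direction, site planes t = 0 and t = L/2;
rev 2: the site reflection and the closed positive half are INLINED so the route imports nothing
beyond the Statement cone) for all N, all even L ≥ 4, every U(N) field U and m > −1: with θ'x =
Function.update x 0 (−x 0) (time reflection through the site planes), Θ'V (x,0) = (V (θ'(x+e₀),
0))⁻¹ and Θ'V (x,j) = V (θ'x, j) for j ≠ 0 (literally `GaugeConfig.negReflect`), and the closed
positive half H = {temporal links (x,0) with x₀ < L/2} ∪ {spatial links (x,j), j ≠ 0, with x₀ ≤ L/2}
(= `WilsonSiteRP.sitePosEdges ∪ sharedEdges`), the positive double U⁺⁺ = (H ? U : Θ'U) and the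
negative double U⁻⁻ = (H ? Θ'U : U) have real non-negative det_AP, and ‖det_AP[U]‖² ≤ Re det_AP[U⁺⁺]
· Re det_AP[U⁻⁻]. Proof route: Lüscher's ξ/η split (MontvayMunster1994 (4.100)–(4.106)) makes
det_AP[U] = B_(U₀)(𝓘_(U₊), 𝓘_(θU₋)) with B_(U₀) positive semidefinite once 1 − 6κ > 0
((4.109)–(4.111)); Cauchy–Schwarz. All other axes and translates follow by lattice symmetries
(det_AP is a class function of the field: the twist slice moves by a centre gauge transformation).
The rev-2 term is proved EQUAL (propext) to -/
@[route_item "route-QuantumFields-WilsonQuarkChessboard"]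
def BackgroundSchwarz : Prop :=
  ∀ (N L : ℕ) [NeZero L], Even L → 4 ≤ L → ∀ (U : Literature.MathematicalPhysics.QuantumFieldTheory.GaugeConfig 4 L (Matrix.unitaryGroup (Fin N) ℂ)) (m : ℝ), -1 < m → let dAP : Literature.MathematicalPhysics.QuantumFieldTheory.GaugeConfig 4 L (Matrix.unitaryGroup (Fin N) ℂ) → ℂ := fun V => (Literature.MathematicalPhysics.QuantumLattice.wilsonDirac (Literature.MathematicalPhysics.QuantumLattice.unitaryFundamentalRep (Fin N) ℂ) (fun e => if (e.1 e.2).val + 1 = L then -V e else V e) m 1).det; let θ : Literature.MathematicalPhysics.QuantumFieldTheory.Site 4 L → Literature.MathematicalPhysics.QuantumFieldTheory.Site 4 L := fun x => Function.update x 0 (-x 0); let Θ : Literature.MathematicalPhysics.QuantumFieldTheory.GaugeConfig 4 L (Matrix.unitaryGroup (Fin N) ℂ) → Literature.MathematicalPhysics.QuantumFieldTheory.GaugeConfig 4 L (Matrix.unitaryGroup (Fin N) ℂ) := fun V e => if e.2 = 0 then (V (θ (Literature.MathematicalPhysics.QuantumFieldTheory.Site.shift e.1 0), 0))⁻¹ else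 V (θ e.1, e.2); let pos : Literature.MathematicalPhysics.QuantumFieldTheory.Edge 4 L → Prop := fun e => if e.2 = 0 then (e.1 0).val < L / 2 else (e.1 0).val ≤ L / 2; let Upp : Literature.MathematicalPhysics.QuantumFieldTheory.GaugeConfig 4 L (Matrix.unitaryGroup (Fin N) ℂ) := fun e => if pos e then U e else Θ U e; let Umm : Literature.MathematicalPhysics.QuantumFieldTheory.GaugeConfig 4 L (Matrix.unitaryGroup (Fin N) ℂ) := fun e => if pos e then Θ U e else U e; 0 ≤ (dAP Upp).re ∧ (dAP Upp).im = 0 ∧ 0 ≤ (dAP Umm).re ∧ (dAP Umm).im = 0 ∧ ‖dAP U‖ ^ 2 ≤ (dAP Upp).re * (dAP Umm).re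

-- `BackgroundSchwarz` holds: proved by `Summit.QuantumFields.QCD.Cruxes.CriticalLineDiamagnetism.ChessboardCellGain.stub_backgroundSchwarz` @ 2722fd865c09 (its module imports this route file, so no `_holds` link can be stated here).

/-- item stmt-QuantumFields-9309 · support · rank 5 · open · by planner
why it might fail: Composite of MassiveBridge and ChiralDescent (constructive massive QCD + chiral descent); as hard as both together, no independent failure mode.
sources: Balaban1989LargeFieldII, Balaban1988Convergent, BalabanOcarrollSchor1989, Dimock2022QED3, JaffeWitten2000 §5, Literature.Barriers.QuantumFields.UVStabilityNonUniqueness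
[crux] (card K2 + the rest of the construction; the engine's customer) QuarkChessboard →
FlatCellOptimal → QCD: given the pathwise local domination |Π_f det_AP D_W[U, m_f]| ≤ e^(−Σ_f Σ_c
φ_c(U, m_f)) with φ_c ≥ φ_flat for U(3) ⊃ SU(3) fields at bare masses near 0, construct for N_f = 2,
3 a mass-independent regularisation with HasMassScaling along which (i) a Bałaban-type block RG with
dynamical Wilson quarks is UV-stable — large-field regions Z suppressed by the Wilson action alone,
the quark weight contributing at most its flat bulk value on Z (C ∧ K), small fields by fermionic
cluster expansions (BOS technology) with m_crit(k) tuned inside the flow — giving IsQCDAlong along a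
subsequence (the Statement asks existence along a SEQUENCE), non-trivial non-Gaussian glue and
non-decoupled flavoured pseudoscalars, and (ii) the SU(3) infrared (uniform lattice gap, clustering,
OS reconstruction) gives one Δ > 0 with T.HasMassGap Δ ∧ HasLatticeMassGap Δ; i.e. `QCD`. Ranked 5
(not 2) on purpose: it is the hardest item but moot until 2–4 stand, and it must come after the
decls it quotes. [deps: QuarkChessboard, FlatCellOptimal] [difficulty: open-problem] -/
@[route_item "route-QuantumFields-WilsonQuarkChessboard"]
def DominationBridge : Prop :=
  QuarkChessboard → FlatCellOptimal → QCD

/-- item stmt-QuantumFields-9310 · support · rank 9 · closed · proved by Summit.QuantumFields.QCD.Theorems.wilsonQuarkChessboardQuarkDiamagnetism_proof (prover) · by planner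
sources: BrydgesFrohlichSeiler1979, Seiler1982, arXiv:hep-th/9611055 (Fry: no such bound survives renormalisation in d = 4 — harmless for the unrenormalised lattice det), Lieb1994
[support] (sharp global corollary; the diamagnetic inequality for Wilson quarks, lattice form of the
Hogreve–Schrader–Seiler question) there is δ > 0 such that for all N, even L ≥ 4, every U(N) field U
and m ∈ (−δ, δ): ‖det_AP D_W[U]‖ ≤ Re det_AP D_W[𝟙]. Glue: from QuarkChessboard and FlatCellOptimal
by 0 ≤ Re det_AP[R_c U] ≤ Re det_AP[𝟙] for every cell and the L⁴-th root (provable now GIVEN ranks 2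
and 3); filed so that one explicit configuration beating the free antiperiodic determinant refutes C
∧ K at once. [difficulty: M] -/
@[route_item "route-QuantumFields-WilsonQuarkChessboard", crux]
def QuarkDiamagnetism : Prop :=
  ∃ δ : ℝ, 0 < δ ∧ ∀ (N L : ℕ) [NeZero L], Even L → 4 ≤ L → ∀ (U : Literature.MathematicalPhysics.QuantumFieldTheory.GaugeConfig 4 L (Matrix.unitaryGroup (Fin N) ℂ)) (m : ℝ), -δ < m → m < δ → let dAP : Literature.MathematicalPhysics.QuantumFieldTheory.GaugeConfig 4 L (Matrix.unitaryGroup (Fin N) ℂ) → ℂ := fun V => (Literature.MathematicalPhysics.QuantumLattice.wilsonDirac (Literature.MathematicalPhysics.QuantumLattice.unitaryFundamentalRep (Fin N) ℂ) (fun e => if (e.1 e.2).val + 1 = L then -V e else V e) m 1).det; ‖dAP U‖ ≤ (dAP 1).re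

-- `QuarkDiamagnetism` holds: proved by `Summit.QuantumFields.QCD.Theorems.wilsonQuarkChessboardQuarkDiamagnetism_proof` (its module imports this route file, so no `_holds` link can be stated here).

-- earlier Assembly (stmt-QuantumFields-9311, replaced 2026-08-16T19:39:04Z -> stmt-QuantumFields-16585): proved by Summit.QuantumFields.QCD.Theorems.wilsonQuarkChessboard_assembly_proof — QuarkChessboard → FlatCellOptimal → DominationBridge → QCD
/-- item stmt-QuantumFields-16585 · assembly · rank 1 · closed · proved by Summit.QuantumFields.QCD.Theorems.wilsonQuarkChessboard_assembly_proof @ 6118d132dc72 (prover) · by planner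
sources: FrohlichIsraelLiebSimon1978, JaffeWitten2000
[assembly] SHARP closing path of the route: BackgroundSchwarz → FlatCellOptimal → DominationBridge →
QCD (items #4, #3, #5 ⊢ QCD). With the bridge B (:= QuarkChessboard → FlatCellOptimal → QCD by
definition), the background Schwarz inequality S — PROVED in the tree
(…Cruxes.CriticalLineDiamagnetism.ChessboardCellGain.stub_backgroundSchwarz @ 2722fd865c09, chain
Theorems/WilsonQuarkChessboardBackgroundSchwarz*.lean) — closes QCD given the flat-cell optimum K
and B, because S → C (the quark chessboard, item #2) is the landed Fröhlich–Israel–Lieb–Simon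
iteration over all translates and all four axes
(…ChessboardCellGain.stub_quarkChessboard_of_schwarz,
Theorems/QuarksAsStableActionCriticalLineDiamagnetismStubQuarkChessboardOfSchwarz.lean, p112660).
One-line proof: `fun hS hK hB => hB
(Summit.QuantumFields.QCD.Cruxes.CriticalLineDiamagnetism.ChessboardCellGain.stub_quarkChessboard_of_schwarz
hS) hK` (planner Sketch.lean `assemblyR_holds`, rc 0, axioms propext/Classical.choice/Quot.sound; it
must live in a Theorems file importing that module — the route file cannot import it, import cycle).
The WEAK path C → K → B → QCD is the deciding theorem `closes` (unchanged, modus ponens); it was -/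
@[route_item "route-QuantumFields-WilsonQuarkChessboard"]
def Assembly : Prop :=
  BackgroundSchwarz → FlatCellOptimal → DominationBridge → QCD

-- `Assembly` holds: proved by `Summit.QuantumFields.QCD.Theorems.wilsonQuarkChessboard_assembly_proof` @ 6118d132dc72 (its module imports this route file, so no `_holds` link can be stated here).

/-! D-0027 §2.1 — DECIDING THEOREM (planner-authored via `route open/edit --closes-file`; by planner-rrepair-QuantumFields-WilsonQuarkChess-99a4cee3-0 2026-08-16T23:22:39Z):
its hypotheses are this route's items and its conclusion the sub-problem Statement (glue_lint), and it elaborates with this file. -/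

@[closes "route-QuantumFields-WilsonQuarkChessboard"] theorem closes : QuarkChessboard → FlatCellOptimal → MassiveBridge → ChiralDescent → QCD :=
  fun hC hK hM hD => hD (hM hC hK)

end Summit.QuantumFields.QCD.Theses.WilsonQuarkChessboard
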